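import Summits.BirchSwinnertonDyer.BirchSwinnertonDyer.Theorems.SignedLowerHalvesSmallImageLowerHalfBothSignsRttJunctionShaLocCount
import Summits.BirchSwinnertonDyer.BirchSwinnertonDyer.Theorems.SignedLowerHalvesSmallImageLowerHalfBothSignsRttJunctionLocalNs
import Summits.BirchSwinnertonDyer.BirchSwinnertonDyer.Theorems.SignedLowerHalvesSmallImageLowerHalfBothSignsRttJunctionEulerDict
import Literature.NumberTheory.GaloisRepresentations.LocalGaloisGroupFrobeniusProofs
import HarnessLib

/-!
# Route `SignedLowerHalves`, crux L `SmallImageLowerHalfBothSigns` (stmt-BirchSwinnertonDyer-23599), line `rtt_w3` v30 — stub S3α′ (`stub_junctionShaPT_ns`),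
# brick α2-lev (part 3): THE LOCAL HYPOTHESES OF THE LEVELWISE BOUND, DISCHARGED AT THE PLACES `w ∈ P` AWAY FROM `p` from clause (R) of `CharRoadFrameSupp`,
# the exponent of `θ′` on inertia, and the Frobenius of the cyclotomic tower

INPUTS hand `bsd-inputs-honda-p1` g28 under LEAD `cruxlead-stmt-BirchSwinnertonDyer-23599` g14 (cell `bsd-ssimc`; TAKE-GRANT 2026-08-31T06:30Z «α2-lev»); helper
`--supports stmt-BirchSwinnertonDyer-23599`. THEOREMS ONLY (no definition, no named fact, no instance, no `sorry`). Sequel of parts 1–2 (`…RttJunctionShaLocCountCore`, `…RttJunctionShaLocCount`).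
WHAT. At a place `w ∤ p` of `K`:
* `mu_eq_self_of_mem_absInertia` — local inertia fixes `μ_{p^k}(K̄_w)` (tree `smul_eq_self_of_pow_eq_one_of_mem_absInertia`);
* ★★ `exists_bound_semilocCoh_two_of_ramified` — if (R) SOME inertia element above `w` is not killed by `θ′`, `θ′` has exponent `m₀ ≠ 0` on the inertia above `w` (frame: `hθfin` + `hker`,
  g26 `apply_pow_eq_one_of_mem_inertia`) and the decomposition group of `w` in `K_∞/K` is non-trivial (`κ(res σ) ≠ 0` for some `σ ∈ Γ_{K_w}`), then ALL levels
  `H²(Γ_{K_w}, Maps(Γ_K ⧸ U_n, X_k))` of the degree-2 semilocal Iwasawa module at `w` are finite and UNIFORMLY bounded (part 2 with `τ` = a local inertia element, g26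
  `exists_mem_absInertia_apply_ne_one` / `muTwistO_resGalOfEmb_of_mem_absInertia` / `mem_localSubgroupOfEmb_of_mem_absInertia`; `u − 1 ∣ m₀ ∣ m₀² ∣ p^d`);
* ★ `exists_toAdd_restrict_resGalOfEmb_ne_zero` — for the RESTRICTED CYCLOTOMIC tower `κ_ℚ|_K` (`K` quadratic) every `w ∤ p` is finitely decomposed: the local Frobenius `σ` has
  `κ(res σ) = deg(w)·f_ℓ ≠ 0` (g27 `toAdd_restrict_eq_natCast_mul_frobeniusExponent`, tree `exists_isAbsArithFrob_holds`, `isArithFrobAt_absGaloisRestrict_adicCompletionPrime_iff`);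
* `exists_bound_semilocCoh_two_of_isNonsplitIn` — at a non-split place (e.g. `vp`) only the `τ`-hypothesis remains (flag: Imai-type input at `vp`);
* ★★★ `exists_bound_semilocCoh_two_of_frameSupp` — the two combined, in the frame's vocabulary: at every `w ∈ supp(p𝔣)` with `p ∉ w`, clause (R) of `CharRoadFrameSupp` + the exponent give the
  uniform levelwise bound, hence (LEAD p813183) `(L₂ w).H` finite.
HONEST FRAMING: the place `vp` above `p` is NOT covered (there the τ-hypothesis of part 2 is the height-two / Imai-type finiteness of `θ′` over `K_v(μ_{p^∞})`); nothing about
S3α′, E2, crux L or BSD is proved; all remain OPEN and are proved for NO curve.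
References: [NeukirchANT1999] II §9 Prop. (9.6); [SerreLocalFields1979] IV §4 Prop. 16; [Washington1997] §13.1–§13.2, Prop. 13.2; [PerrinRiou1994Invent] §1.3;
[NeukirchSchmidtWingberg2008] (7.2.6), (8.6.2)–(8.6.3).
-/

set_option autoImplicit false
set_option linter.dupNamespace false -- D-0017: single-problem summit, the namespace repeats the problem name by design
noncomputable section

open scoped Classical
open NumberField IsDedekindDomain Field CategoryTheory Function ValuativeRel

namespace Summit.BirchSwinnertonDyer.BirchSwinnertonDyer.Theorems.SmallImageRttJunctionSha

open Literature.NumberTheory.EllipticCurves Literature.NumberTheory.GaloisRepresentations Literature.NumberTheory.GaloisRepresentations.DiscreteGaloisModule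
  Literature.NumberTheory.ComplexMultiplication.EllipticUnits.JohnsonLeungKings2011
  Summit.BirchSwinnertonDyer.BirchSwinnertonDyer.Theorems.SmallImageRttD2J1
  Summit.BirchSwinnertonDyer.BirchSwinnertonDyer.Theorems.SmallImageRttD2Seq

section OffP

variable {K : Type} [Field K] [NumberField K] {p : ℕ} [Fact p.Prime] (S : Set (PadicAlgCl p)) [FiniteDimensional ℚ_[p] (padicCoeffField S)]
  (κ : ZpExtension K p) (θ' : absoluteGaloisGroup K →ₜ* (padicCoeffIntegers S)ˣ) (P : Set (HeightOneSpectrum (𝓞 K))) (w : HeightOneSpectrum (𝓞 K))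

omit [FiniteDimensional ℚ_[p] (padicCoeffField S)] in
/-- **Local inertia at `w ∤ p` fixes the `p^k`-th roots of unity of `K̄_w`** (they have order prime to the residue characteristic; tree `smul_eq_self_of_pow_eq_one_of_mem_absInertia`).
[cite: SerreLocalFields1979, IV §4 Prop. 16] [cite: SerreInventiones1972, §1.3] -/
theorem mu_eq_self_of_mem_absInertia (hwp : ((p : ℕ) : 𝓞 K) ∉ w.asIdeal) (k : ℕ) {τ : absoluteGaloisGroup (w.adicCompletion K)}
    (hτ : τ ∈ absInertia (w.adicCompletion K)) (ζ : MuCarrier (w.adicCompletion K) (p ^ k)) : mu (w.adicCompletion K) (p ^ k) τ ζ = ζ := by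
  apply muVal_injective (w.adicCompletion K) (p ^ k)
  rw [muVal_apply]
  ext
  rw [Units.coe_smul]
  have hpk : ¬ ringChar (IsLocalRing.ResidueField 𝒪[w.adicCompletion K]) ∣ p ^ k := fun h ↦
    w.ringChar_residueField_adicCompletion_ne hwp
      (((Nat.prime_dvd_prime_iff_eq ringChar_residueField_prime (Fact.out : p.Prime)).mp (ringChar_residueField_prime.dvd_of_dvd_pow h)))
  have hζ : ((muVal (w.adicCompletion K) (p ^ k) ζ : (AlgebraicClosure (w.adicCompletion K))ˣ) : AlgebraicClosure (w.adicCompletion K)) ^ p ^ k = 1 := by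
    rw [← Units.val_pow_eq_pow_val, muVal_pow_eq_one, Units.val_one]
  exact smul_eq_self_of_pow_eq_one_of_mem_absInertia hτ (pow_pos (Fact.out : p.Prime).pos k) hpk hζ

/-- ★★ **UNIFORM LEVELWISE BOUND AT A RAMIFIED PLACE `w ∤ p`** (the local hypotheses of part 2 discharged): (R) some inertia element above `w` is not killed by `θ′`; `θ′` has exponent
`m₀ ≠ 0` on the inertia groups above `w`; and the decomposition group of `w` in `K_∞/K` is non-trivial (`κ(res σ) ≠ 0` for some `σ ∈ Γ_{K_w}`). Then every
`H²(Γ_{K_w}, Maps(Γ_K ⧸ U_n, X_k))` is finite, of cardinality bounded independently of `n, k`. [cite: PerrinRiou1994Invent, §1.3] [cite: NeukirchSchmidtWingberg2008, (7.2.6), (8.6.2)]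
[cite: Washington1997, Prop. 13.2] -/
theorem exists_bound_semilocCoh_two_of_ramified (hwp : ((p : ℕ) : 𝓞 K) ∉ w.asIdeal)
    (hR : ∃ 𝔓 ∈ w.primesAbove, ∃ τ ∈ 𝔓.inertia (absoluteGaloisGroup K), θ' τ ≠ 1)
    {m₀ : ℕ} (hm₀ : m₀ ≠ 0) (hθm : ∀ 𝔓 ∈ w.primesAbove, ∀ τ ∈ 𝔓.inertia (absoluteGaloisGroup K), θ' τ ^ m₀ = 1)
    (hdec : ∃ σ : absoluteGaloisGroup (w.adicCompletion K), (κ (resGalOfEmb (closureEmb (K := K) (w.adicCompletion K)) σ)).toAdd ≠ 0) :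
    (∀ n k, Finite (semilocCoh S κ θ' P w n k 2)) ∧ ∃ B : ℕ, ∀ n k, Nat.card (semilocCoh S κ θ' P w n k 2) ≤ B := by
  -- τ : a local inertia element not killed by `θ′`
  obtain ⟨τ, hτ, hne⟩ := SmallImageRttJunctionLocal.exists_mem_absInertia_apply_ne_one S θ' w hR
  set u : padicCoeffIntegers S := ((θ' (resGalOfEmb (closureEmb (K := K) (w.adicCompletion K)) τ) : (padicCoeffIntegers S)ˣ) : padicCoeffIntegers S) with hu
  -- `u - 1 ∣ m₀ ∣ m₀² ∣ p^d`
  have hum₀ : (θ' (resGalOfEmb (closureEmb (K := K) (w.adicCompletion K)) τ)) ^ m₀ = 1 :=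
    SmallImageRttJunctionLocal.apply_resGalOfEmb_pow_eq_one_of_mem_absInertia S θ' w hθm hτ
  have hupow : u ^ m₀ = 1 := by rw [hu, ← Units.val_pow_eq_pow_val, hum₀, Units.val_one]
  have hu1 : u ≠ 1 := fun h ↦ hne (Units.ext (by rw [← hu, h, Units.val_one]))
  obtain ⟨d, hd⟩ := SmallImageRttJunctionLocal.exists_natCast_sq_dvd_prime_pow S hm₀
  have hum : u - 1 ∣ ((p : ℕ) : padicCoeffIntegers S) ^ d :=
    ((SmallImageRttJunctionLocal.sub_one_dvd_natCast_of_pow_eq_one hupow hu1).trans (Dvd.intro _ (sq ((m₀ : ℕ) : padicCoeffIntegers S)).symm)).trans hd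
  -- σ : `κ(res σ) = p^e · unit`
  obtain ⟨σ, hσ0⟩ := hdec
  have hσ : (κ (resGalOfEmb (closureEmb (K := K) (w.adicCompletion K)) σ)).toAdd =
      (p : ℤ_[p]) ^ (κ (resGalOfEmb (closureEmb (K := K) (w.adicCompletion K)) σ)).toAdd.valuation * PadicInt.unitCoeff hσ0 := by
    rw [mul_comm]; exact PadicInt.unitCoeff_spec hσ0
  exact exists_bound_semilocCoh_two S κ θ' P w (τ := τ)
    (fun n ↦ (mem_localSubgroupOfEmb_iff _ _ _).mp (SmallImageRttJunctionLocal.mem_localSubgroupOfEmb_of_mem_absInertia κ w hwp n hτ))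
    (fun k ζ ↦ mu_eq_self_of_mem_absInertia w hwp k hτ ζ)
    (fun k x ↦ SmallImageRttJunctionLocal.muTwistO_resGalOfEmb_of_mem_absInertia S θ' hwp k hτ x) hum hσ

/-- ★★ **At a place NON-SPLIT in the tower (e.g. `vp`, tree `isNonsplitIn_restrictOfFinrankEqTwo`) only the `τ`-hypothesis remains**: `κ ∘ res_w` onto ⇒ `κ(res σ) = 1 = p⁰·1` for some
`σ`, so the uniform levelwise bound holds as soon as some `τ ∈ Γ_{K_w}` over `K_∞` fixes `μ_{p^∞}(K̄_w)` and acts on `𝒪 ⊗ μ ⊗ θ′` as a scalar `u` with `u − 1 ∣ p^m` — at `vp` this is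
the height-two / Imai-type input «`θ′` is non-trivial (with bounded `θ′(τ) − 1`) on `Gal(K̄_v / K_v K_∞(μ_{p^∞}))`», NOT supplied here. [cite: PerrinRiou1994Invent, §1.3] [cite: Imai1975, Theorem (p. 12)] -/
theorem exists_bound_semilocCoh_two_of_isNonsplitIn (hv : AcSigned.IsNonsplitIn κ w)
    {τ : absoluteGaloisGroup (w.adicCompletion K)} (hτU : ∀ n, resGalOfEmb (closureEmb (K := K) (w.adicCompletion K)) τ ∈ κ.layerSubgroup n)
    (hτμ : ∀ (k : ℕ) (ζ : MuCarrier (w.adicCompletion K) (p ^ k)), mu (w.adicCompletion K) (p ^ k) τ ζ = ζ)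
    {u : padicCoeffIntegers S}
    (hτX : ∀ (k : ℕ) (x : OMuCarrier K S (p ^ k)), muTwistO S θ' k (resGalOfEmb (closureEmb (K := K) (w.adicCompletion K)) τ) x = oMuScalar S (p ^ k) u x)
    {m : ℕ} (hum : u - 1 ∣ ((p : ℕ) : padicCoeffIntegers S) ^ m) :
    (∀ n k, Finite (semilocCoh S κ θ' P w n k 2)) ∧ ∃ B : ℕ, ∀ n k, Nat.card (semilocCoh S κ θ' P w n k 2) ≤ B := by
  obtain ⟨σ, hσ⟩ := hv (Multiplicative.ofAdd 1)
  have hσ' : κ (resGalOfEmb (closureEmb (K := K) (w.adicCompletion K)) σ) = Multiplicative.ofAdd 1 := hσ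
  refine exists_bound_semilocCoh_two S κ θ' P w hτU hτμ hτX hum (σ := σ) (e := 0) (u₀ := 1) ?_
  rw [hσ', toAdd_ofAdd, pow_zero, Units.val_one, mul_one]

end OffP

/-! ## The cyclotomic tower is finitely decomposed at every `w ∤ p` -/

section Cyclotomic

variable {p : ℕ} [Fact p.Prime] (hp : p ≠ 2) {κ : ZpExtension ℚ p} {K : Type} [Field K] [NumberField K] (hK2 : Module.finrank ℚ K = 2)

/-- ★ **The restricted cyclotomic `ℤ_p`-tower of `K` is finitely decomposed at every `w ∤ p`**: for the local Frobenius `σ ∈ Γ_{K_w}` (tree `exists_isAbsArithFrob_holds`; an arithmetic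
Frobenius at the prime `𝔓₀` of the chosen embedding, `isArithFrobAt_absGaloisRestrict_adicCompletionPrime_iff`), `κ_K(res σ) = deg(w) · f_ℓ ≠ 0` (g27 `toAdd_restrict_eq_natCast_mul_frobeniusExponent`:
`χ_p(Frob_w) = N(w) = ℓ^{deg w}`, `f_ℓ ≠ 0`). [cite: Washington1997, §13.1] [cite: SerreAbelianLadic1968, Ch. I §1.2] [cite: NeukirchANT1999, II §9 Prop. (9.6)] -/
theorem exists_toAdd_restrict_resGalOfEmb_ne_zero (hκ : κ.IsCyclotomic) {γ : absoluteGaloisGroup ℚ} (hγ : κ.IsTopGenerator γ) (hcv : IsCyclotomicVariable p γ)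
    {w : HeightOneSpectrum (𝓞 K)} {ℓ : ℕ} (hℓ : ℓ.Prime) (hℓp : ℓ ≠ p) (hℓw : (ℓ : 𝓞 K) ∈ w.asIdeal) :
    ∃ σ : absoluteGaloisGroup (w.adicCompletion K), ((κ.restrictOfFinrankEqTwo hp K hK2) (resGalOfEmb (closureEmb (K := K) (w.adicCompletion K)) σ)).toAdd ≠ 0 := by
  obtain ⟨σ, hσ⟩ := exists_isAbsArithFrob_holds (F := w.adicCompletion K)
  have hq : IsNonarchimedeanLocalField.residueFieldCard (w.adicCompletion K) = Nat.card (𝓞 K ⧸ w.asIdeal) := by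
    rw [Literature.NumberTheory.Automorphic.residueFieldCard_adicCompletion_eq, w.residueCard_eq_card_quotient]
  have hφ : IsArithFrobAt (𝓞 K) (resGalOfEmb (closureEmb (K := K) (w.adicCompletion K)) σ) (adicCompletionPrime K w) :=
    (isArithFrobAt_absGaloisRestrict_adicCompletionPrime_iff K w hq σ).mpr hσ
  refine ⟨σ, ?_⟩
  rw [SmallImageRttJunctionEuler.toAdd_restrict_eq_natCast_mul_frobeniusExponent hp hK2 hκ hγ hcv hℓ hℓp hℓw (SmallImageRttJunctionEuler.residueCard_eq_pow_log hℓ hℓw)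
    (adicCompletionPrime_mem_primesAbove K w) hφ]
  refine mul_ne_zero ?_ (Summit.BirchSwinnertonDyer.Rank1Residual.X2.EulerFactorAlgebra.frobeniusExponent_natCast_ne_zero
    ((Nat.coprime_primes Fact.out hℓ).mpr (Ne.symm hℓp)) hℓ.one_lt)
  -- `deg(w) = log_ℓ N(w) ≠ 0`
  have hN : 1 < w.residueCard := w.one_lt_residueCard
  have hlog : Nat.log ℓ w.residueCard ≠ 0 := by
    intro h0
    have h := SmallImageRttJunctionEuler.residueCard_eq_pow_log hℓ hℓw
    rw [h0, pow_zero] at h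
    omega
  exact_mod_cast hlog

/-- ★★★ **α2-lev AT EVERY PLACE OF THE FRAME LEVEL AWAY FROM `p`, IN THE FRAME'S VOCABULARY**: for the restricted cyclotomic tower `κ_K`, a character `θ′` with clause (R) of
`CharRoadFrameSupp S 𝔣 θ′` and exponent `m₀ ≠ 0` on the inertia away from `p` (⟸ `hθfin` + `hker` by g26 `apply_pow_eq_one_of_mem_inertia`), and every `w ∈ supp(p𝔣)` with `p ∉ w`:
ALL levels of the degree-2 semilocal Iwasawa module at `w` are finite and UNIFORMLY bounded — so `(L₂ w).H` is finite (LEAD p813183). The place `vp` is NOT covered here.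
[cite: PerrinRiou1994Invent, §1.3] [cite: NeukirchSchmidtWingberg2008, (8.6.2)–(8.6.3)] [cite: Washington1997, Prop. 13.2] -/
theorem exists_bound_semilocCoh_two_of_frameSupp (S : Set (PadicAlgCl p)) [FiniteDimensional ℚ_[p] (padicCoeffField S)]
    (hκ : κ.IsCyclotomic) {γ : absoluteGaloisGroup ℚ} (hγ : κ.IsTopGenerator γ) (hcv : IsCyclotomicVariable p γ)
    (θ' : absoluteGaloisGroup K →ₜ* (padicCoeffIntegers S)ˣ) (𝔣 : Ideal (𝓞 K))
    (hR : ∀ w ∈ suppPF p 𝔣, ((p : ℕ) : 𝓞 K) ∉ w.asIdeal → ∃ 𝔓 ∈ w.primesAbove, ∃ τ ∈ 𝔓.inertia (absoluteGaloisGroup K), θ' τ ≠ 1)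
    {m₀ : ℕ} (hm₀ : m₀ ≠ 0)
    (hθm : ∀ w : HeightOneSpectrum (𝓞 K), ((p : ℕ) : 𝓞 K) ∉ w.asIdeal → ∀ 𝔓 ∈ w.primesAbove, ∀ τ ∈ 𝔓.inertia (absoluteGaloisGroup K), θ' τ ^ m₀ = 1)
    {w : HeightOneSpectrum (𝓞 K)} (hw : w ∈ suppPF p 𝔣) (hwp : ((p : ℕ) : 𝓞 K) ∉ w.asIdeal) :
    (∀ n k, Finite (semilocCoh S (κ.restrictOfFinrankEqTwo hp K hK2) θ' (suppPF p 𝔣) w n k 2)) ∧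
      ∃ B : ℕ, ∀ n k, Nat.card (semilocCoh S (κ.restrictOfFinrankEqTwo hp K hK2) θ' (suppPF p 𝔣) w n k 2) ≤ B := by
  classical
  -- the rational prime `ℓ` below `w` (the residue characteristic)
  haveI : Finite (𝓞 K ⧸ w.asIdeal) := Ideal.finiteQuotientOfFreeOfNeBot w.asIdeal w.ne_bot
  letI : Fintype (𝓞 K ⧸ w.asIdeal) := Fintype.ofFinite _
  letI : Field (𝓞 K ⧸ w.asIdeal) := Ideal.Quotient.field _
  obtain ⟨n, hℓ, -⟩ := FiniteField.card (𝓞 K ⧸ w.asIdeal) (ringChar (𝓞 K ⧸ w.asIdeal))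
  have hℓw : ((ringChar (𝓞 K ⧸ w.asIdeal) : ℕ) : 𝓞 K) ∈ w.asIdeal := by
    rw [← Ideal.Quotient.eq_zero_iff_mem, map_natCast]
    exact ringChar.Nat.cast_ringChar
  have hℓp : ringChar (𝓞 K ⧸ w.asIdeal) ≠ p := fun h ↦ hwp (h ▸ hℓw)
  exact exists_bound_semilocCoh_two_of_ramified S (κ.restrictOfFinrankEqTwo hp K hK2) θ' (suppPF p 𝔣) w hwp (hR w hw hwp) hm₀ (hθm w hwp)
    (exists_toAdd_restrict_resGalOfEmb_ne_zero hp hK2 hκ hγ hcv hℓ hℓp hℓw)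

end Cyclotomic

end Summit.BirchSwinnertonDyer.BirchSwinnertonDyer.Theorems.SmallImageRttJunctionSha

end
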